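import Summits.QuantumFields.YangMills.Theses.BackwardLiouvilleRigidity
import Literature.MathematicalPhysics.QuantumFieldTheory.Balaban1983to89.B12ContinuousTransportInvarianceOn
import Literature.Probability.LatticeModels.ProductMeasureTools
import Summits.QuantumFields.YangMills.Theorems.AlphaInputsT3ACv3AdaptedClass
import HarnessLib

/-!
# Crux `OneStepBackwardContractionAdm` (stmt-QuantumFields-23156, route `BackwardLiouvilleRigidity`, rung R3), LINE 2 «organ-fibre-laplace»
# (planner ym-r3-idea-1 g12/g13): stub U `stub_aeUpgrade` — A.E. ⇒ EVERYWHERE ON THE SMALL-FIELD WINDOW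

The organ's clustered-second-difference clause is produced by the fibre step (stub S) for `dU ⊗ dU`-a.e. pairs `(U, U′)`
(regime `b ≠ b′`: the square `U, U[b ↦ U′b], U[b′ ↦ U′b′], U[b ↦ U′b][b′ ↦ U′b′]`) and for `dU^{⊗4}`-a.e. quadruples (regime
`b = b′`: `x₀, x₀[b ↦ x₁b], x₀[b ↦ x₂b], x₀[b ↦ x₃b]`), for the fibre log-Laplace transform `Λ`, which agrees with `log r − log r′`
only `dU`-a.e. on the window `{PlaqSmall θ}`.  This file upgrades these to the EVERYWHERE clause of the organ for
`log r − log r′ − (Wilson term)` on the window, for `r, r′` continuous and positive there: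

* §1–§2 [folklore] the parametrising bond-update maps are MEASURE PRESERVING for the product Haar measure `dU`
  (one-coordinate resampling = finite version of `Literature.Probability.LatticeModels.map_update_infinitePi_prod`;
  two distinct coordinates of a product are independent, Mathlib `iIndepFun_pi`; `measurePreserving_prodAssoc`), so the
  a.e. identity `Λ = log r − log r′` transports to each of the four configurations (`QuasiMeasurePreserving.ae`);
* §3 [folklore] an a.e. bound for a function continuous on an OPEN set holds everywhere there as soon as the measure
  charges every non-empty open set (`Measure.dense_of_ae` + `ContinuousWithinAt.closure_le`);
* §4 the two square lemmas (generic open window `S`, generic `g` continuous on `S`): every square `U ∼_b V`, `U ∼_{b′} W`,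
  `V ∼_{b′} Z`, `W ∼_b Z` in the window is the value of the continuous parametrisation at one point of the open set
  where all four configurations lie in `S`;
* §5 the window is open and the Wilson term is continuous on `SU(2)`-fields (`continuous_dist1_SU`, `continuous_plaqHol_SU`
  of `…B12ContinuousTransportInvarianceOn`, `AlphaInputsT3AC.continuous_reTr_su2`; product Haar charges open sets:
  `isOpenPosMeasure_fieldMeasure_SU`);
* §6 `stub_aeUpgrade` with the REGISTERED SIGNATURE VERBATIM (skeleton `Cruxes/FluctuationComparisonRegPrIntL/Lines/organ_fibre_laplace.lean`).

Width seat ym-line-sfw-p2-w5 g11 (cell ym-idea-1; free hands, R3 family), `--supports stmt-QuantumFields-23156`.  THEOREMS ONLY.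
HONEST FRAMING: [folklore] measure theory / topology; the organ's content is stub S (`stub_fibreStepAdm`, XL, OPEN); no organ,
crux, rung (R3 is a RECORD rung) or summit is proved; the Yang–Mills mass gap is NOT proved by any of this.
-/

set_option autoImplicit false

noncomputable section

namespace Summit.QuantumFields.YangMills.Theorems.BackwardLiouvilleRigidity.FibreLaplace

open MeasureTheory Filter Topology Set
open Literature.MathematicalPhysics.QuantumFieldTheory.Balaban1983to89
open T3ContinuumYM3Torus T3NestedUnitLaws T3UnitLawDensityEML BalabanUVClass T3UnitScaleTilt
open Literature.MathematicalPhysics.QuantumFieldTheory.Balaban1983to89.B12ContinuousTransportInvariance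
  (isOpenPosMeasure_fieldMeasure_SU)
open Literature.MathematicalPhysics.QuantumFieldTheory.Balaban1983to89.B12ContinuousTransportInvarianceOn
  (continuous_dist1_SU continuous_plaqHol_SU)

namespace AeUpgrade

/-! ## §1 Resampling coordinates of a finite power of one probability measure -/

section Resampling

variable {ι X : Type*} [Fintype ι] [MeasurableSpace X] (m : Measure X) [IsProbabilityMeasure m]

/-- **One-coordinate resampling** (finite version of `Literature.Probability.LatticeModels.map_update_infinitePi_prod`): the update map
`(x, y) ↦ x[i ↦ y]` pushes `m^{⊗ι} ⊗ m` forward to `m^{⊗ι}`. [folklore] -/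
theorem map_update_pi_prod [DecidableEq ι] (i : ι) :
    ((Measure.pi fun _ : ι => m).prod m).map (fun p : (ι → X) × X => Function.update p.1 i p.2) =
      Measure.pi fun _ : ι => m := by
  have h := Literature.Probability.LatticeModels.map_update_infinitePi_prod (fun _ : ι => m) i
  rwa [Measure.infinitePi_eq_pi] at h

/-- The update map `(x, y) ↦ x[i ↦ y]` is measure preserving `m^{⊗ι} ⊗ m → m^{⊗ι}`. [folklore] -/
theorem measurePreserving_update_pi_prod [DecidableEq ι] (i : ι) :
    MeasurePreserving (fun p : (ι → X) × X => Function.update p.1 i p.2)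
      ((Measure.pi fun _ : ι => m).prod m) (Measure.pi fun _ : ι => m) :=
  ⟨measurable_update', map_update_pi_prod m i⟩

/-- **Two distinct coordinates of `m^{⊗ι}` are an `m ⊗ m` sample** (independence of the coordinates, `iIndepFun_pi`). [folklore] -/
theorem measurePreserving_eval_pair {i k : ι} (hik : i ≠ k) :
    MeasurePreserving (fun x : ι → X => (x i, x k)) (Measure.pi fun _ : ι => m) (m.prod m) := by
  have hind : ProbabilityTheory.iIndepFun (fun (l : ι) (ω : ι → X) => ω l) (Measure.pi fun _ : ι => m) :=
    ProbabilityTheory.iIndepFun_pi (X := fun (_ : ι) (y : X) => y) fun _ => aemeasurable_id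
  have h2 := (ProbabilityTheory.indepFun_iff_map_prod_eq_prod_map_map (measurable_pi_apply i).aemeasurable
      (measurable_pi_apply k).aemeasurable).1 (hind.indepFun hik)
  refine ⟨(measurable_pi_apply i).prodMk (measurable_pi_apply k), ?_⟩
  rw [h2]
  congr 1
  · exact (MeasureTheory.measurePreserving_eval (fun _ : ι => m) i).map_eq
  · exact (MeasureTheory.measurePreserving_eval (fun _ : ι => m) k).map_eq

end Resampling

/-! ## §2 Bond updates preserve the product Haar measure `dU` -/

section Bonds

variable {P : Params} {j : ℕ} {G : Type*} [GaugeGroup G] [MeasurableSpace G] [HaarData G]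

/-- **A bond update resampled from Haar preserves `dU`**: `(U, g) ↦ U[b ↦ g]` pushes `dU ⊗ dg` to `dU`. [folklore] -/
theorem measurePreserving_update_fieldMeasure [DecidableEq (PBond P j)] (b : PBond P j) :
    MeasurePreserving (fun p : GaugeField P j G × G => Function.update p.1 b p.2)
      ((fieldMeasure P j G).prod (HaarData.haar : Measure G)) (fieldMeasure P j G) := by
  unfold fieldMeasure
  exact measurePreserving_update_pi_prod _ b

/-- `(U, U') ↦ U[b ↦ U'(b)]` preserves `dU ⊗ dU' → dU`. [folklore] -/
theorem measurePreserving_update_eval [DecidableEq (PBond P j)] (b : PBond P j) :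
    MeasurePreserving (fun x : GaugeField P j G × GaugeField P j G => Function.update x.1 b (x.2 b))
      ((fieldMeasure P j G).prod (fieldMeasure P j G)) (fieldMeasure P j G) :=
  (measurePreserving_update_fieldMeasure b).comp
    ((MeasurePreserving.id (fieldMeasure P j G)).prod (AveragingRT.measurePreserving_eval b))

/-- Two DISTINCT bond variables of `dU` are a Haar ⊗ Haar sample. [folklore] -/
theorem measurePreserving_eval_eval {b b' : PBond P j} (hbb' : b ≠ b') :
    MeasurePreserving (fun U : GaugeField P j G => (U b, U b')) (fieldMeasure P j G)
      ((HaarData.haar : Measure G).prod (HaarData.haar : Measure G)) := by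
  unfold fieldMeasure
  exact measurePreserving_eval_pair _ hbb'

/-- `(U, U') ↦ U[b ↦ U'(b)][b' ↦ U'(b')]` preserves `dU ⊗ dU' → dU` for `b ≠ b'` (two independent resamplings). [folklore] -/
theorem measurePreserving_update_update_eval [DecidableEq (PBond P j)] {b b' : PBond P j} (hbb' : b ≠ b') :
    MeasurePreserving (fun x : GaugeField P j G × GaugeField P j G =>
        Function.update (Function.update x.1 b (x.2 b)) b' (x.2 b'))
      ((fieldMeasure P j G).prod (fieldMeasure P j G)) (fieldMeasure P j G) := by
  have h1 : MeasurePreserving (Prod.map id fun U : GaugeField P j G => (U b, U b'))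
      ((fieldMeasure P j G).prod (fieldMeasure P j G))
      ((fieldMeasure P j G).prod ((HaarData.haar : Measure G).prod (HaarData.haar : Measure G))) :=
    (MeasurePreserving.id (fieldMeasure P j G)).prod (measurePreserving_eval_eval hbb')
  have h2 : MeasurePreserving (MeasurableEquiv.prodAssoc : (GaugeField P j G × G) × G ≃ᵐ GaugeField P j G × G × G).symm
      ((fieldMeasure P j G).prod ((HaarData.haar : Measure G).prod (HaarData.haar : Measure G)))
      (((fieldMeasure P j G).prod (HaarData.haar : Measure G)).prod (HaarData.haar : Measure G)) :=
    (MeasureTheory.measurePreserving_prodAssoc (fieldMeasure P j G) (HaarData.haar : Measure G)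
      (HaarData.haar : Measure G)).symm _
  have h3 : MeasurePreserving (Prod.map (fun p : GaugeField P j G × G => Function.update p.1 b p.2) id)
      (((fieldMeasure P j G).prod (HaarData.haar : Measure G)).prod (HaarData.haar : Measure G))
      ((fieldMeasure P j G).prod (HaarData.haar : Measure G)) :=
    (measurePreserving_update_fieldMeasure b).prod (MeasurePreserving.id _)
  have h4 := ((measurePreserving_update_fieldMeasure (G := G) b').comp h3).comp (h2.comp h1)
  exact h4

/-- `x ↦ x₀[b ↦ x_i(b)]` on the fourfold power `dU^{⊗4}`, `i ≠ 0`, preserves `dU^{⊗4} → dU`. [folklore] -/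
theorem measurePreserving_update_pi4 [DecidableEq (PBond P j)] (b : PBond P j) {i : Fin 4} (hi : (0 : Fin 4) ≠ i) :
    MeasurePreserving (fun x : Fin 4 → GaugeField P j G => Function.update (x 0) b (x i b))
      (Measure.pi fun _ : Fin 4 => fieldMeasure P j G) (fieldMeasure P j G) :=
  (measurePreserving_update_eval b).comp (measurePreserving_eval_pair (fieldMeasure P j G) hi)

end Bonds

/-! ## §3 An a.e. bound on an open set for a function continuous there holds everywhere on it -/

/-- **A.E. ⇒ EVERYWHERE for a measure charging open sets**: if `f` is continuous on the open set `O` and `f ≤ C` a.e. on `O`, then `f ≤ C` on `O`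
(`{a.e.-good}` is dense, `Measure.dense_of_ae`; pass to the limit inside `O`, `ContinuousWithinAt.closure_le`). [folklore] -/
theorem le_on_open_of_ae {Ω : Type*} [TopologicalSpace Ω] [MeasurableSpace Ω] {ν : Measure Ω} [ν.IsOpenPosMeasure]
    {O : Set Ω} (hO : IsOpen O) {f : Ω → ℝ} (hf : ContinuousOn f O) {C : ℝ}
    (h : ∀ᵐ ω ∂ν, ω ∈ O → f ω ≤ C) : ∀ ω ∈ O, f ω ≤ C := by
  intro ω hω
  have hdense : Dense {ω | ω ∈ O → f ω ≤ C} := Measure.dense_of_ae h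
  have hclos : ω ∈ closure (O ∩ {ω | ω ∈ O → f ω ≤ C}) := hdense.open_subset_closure_inter hO hω
  have hcont : ContinuousWithinAt f (O ∩ {ω | ω ∈ O → f ω ≤ C}) ω :=
    (hf.continuousAt (hO.mem_nhds hω)).continuousWithinAt
  exact hcont.closure_le hclos continuousWithinAt_const fun y hy => hy.2 hy.1

/-! ## §4 The square of four configurations: everywhere from a.e., generic open window `S` and generic `g` continuous on `S` -/

section Square

variable {P : Params} {j : ℕ} {G : Type*} [GaugeGroup G] [MeasurableSpace G] [HaarData G] [TopologicalSpace G]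

/-- **Two distinct bonds.** If `|g(U) − g(U[b↦h]) − (g(U[b′↦h′]) − g(U[b↦h][b′↦h′]))| ≤ C` for `dU ⊗ dU′`-a.e. `(U, U′)` (`h = U′(b)`, `h′ = U′(b′)`)
whenever the four configurations lie in the open set `S`, and `g` is continuous on `S`, then the bound holds for EVERY square `U, V, W, Z ∈ S` with
`U ∼_b V`, `U ∼_{b′} W`, `V ∼_{b′} Z`, `W ∼_b Z` (`∼_e` = agree off the bond `e`). [folklore] -/
theorem square_le_of_ae_ne [DecidableEq (PBond P j)] [(fieldMeasure P j G).IsOpenPosMeasure]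
    {S : Set (GaugeField P j G)} (hS : IsOpen S) {g : GaugeField P j G → ℝ} (hg : ContinuousOn g S) (C : ℝ)
    {b b' : PBond P j} (hbb' : b ≠ b')
    (hae : ∀ᵐ x ∂((fieldMeasure P j G).prod (fieldMeasure P j G)), x.1 ∈ S → Function.update x.1 b (x.2 b) ∈ S →
      Function.update x.1 b' (x.2 b') ∈ S → Function.update (Function.update x.1 b (x.2 b)) b' (x.2 b') ∈ S →
      |g x.1 - g (Function.update x.1 b (x.2 b)) - (g (Function.update x.1 b' (x.2 b')) -
        g (Function.update (Function.update x.1 b (x.2 b)) b' (x.2 b')))| ≤ C) :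
    ∀ U V W Z : GaugeField P j G, U ∈ S → V ∈ S → W ∈ S → Z ∈ S → (∀ e, e ≠ b → U e = V e) → (∀ e, e ≠ b' → U e = W e) →
      (∀ e, e ≠ b' → V e = Z e) → (∀ e, e ≠ b → W e = Z e) → |g U - g V - (g W - g Z)| ≤ C := by
  intro U V W Z hU hV hW hZ hUV hUW hVZ hWZ
  -- the three non-trivial continuous parametrisations `X × X → X`
  set Φ₂ : GaugeField P j G × GaugeField P j G → GaugeField P j G := fun x => Function.update x.1 b (x.2 b) with hΦ₂
  set Φ₃ : GaugeField P j G × GaugeField P j G → GaugeField P j G := fun x => Function.update x.1 b' (x.2 b') with hΦ₃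
  set Φ₄ : GaugeField P j G × GaugeField P j G → GaugeField P j G :=
    fun x => Function.update (Function.update x.1 b (x.2 b)) b' (x.2 b') with hΦ₄
  have hev : ∀ e : PBond P j, Continuous fun x : GaugeField P j G × GaugeField P j G => x.2 e :=
    fun e => (continuous_apply e).comp continuous_snd
  have hc₁ : Continuous fun x : GaugeField P j G × GaugeField P j G => x.1 := continuous_fst
  have hc₂ : Continuous Φ₂ := continuous_fst.update b (hev b)
  have hc₃ : Continuous Φ₃ := continuous_fst.update b' (hev b')
  have hc₄ : Continuous Φ₄ := (continuous_fst.update b (hev b)).update b' (hev b')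
  -- the open set where all four configurations are in the window
  set O : Set (GaugeField P j G × GaugeField P j G) := {x | x.1 ∈ S ∧ Φ₂ x ∈ S ∧ Φ₃ x ∈ S ∧ Φ₄ x ∈ S} with hO
  have hOo : IsOpen O :=
    (hS.preimage hc₁).inter ((hS.preimage hc₂).inter ((hS.preimage hc₃).inter (hS.preimage hc₄)))
  have hfc : ContinuousOn (fun x => |g x.1 - g (Φ₂ x) - (g (Φ₃ x) - g (Φ₄ x))|) O :=
    (((hg.comp hc₁.continuousOn fun x hx => hx.1).sub (hg.comp hc₂.continuousOn fun x hx => hx.2.1)).sub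
      ((hg.comp hc₃.continuousOn fun x hx => hx.2.2.1).sub (hg.comp hc₄.continuousOn fun x hx => hx.2.2.2))).abs
  have hall := le_on_open_of_ae hOo hfc (C := C) (by
    filter_upwards [hae] with x hx hxO
    exact hx hxO.1 hxO.2.1 hxO.2.2.1 hxO.2.2.2)
  -- the square `(U, V, W, Z)` is `Φ(x₀)` for `x₀ = (U, U[b ↦ V b][b' ↦ W b'])`
  set x₀ : GaugeField P j G × GaugeField P j G := (U, Function.update (Function.update U b (V b)) b' (W b')) with hx₀
  have h2b : x₀.2 b = V b := by
    show (Function.update (Function.update U b (V b)) b' (W b')) b = V b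
    rw [Function.update_of_ne hbb', Function.update_self]
  have h2b' : x₀.2 b' = W b' := by
    show (Function.update (Function.update U b (V b)) b' (W b')) b' = W b'
    rw [Function.update_self]
  have hV' : Function.update U b (V b) = V := by
    funext e
    by_cases he : e = b
    · subst he; rw [Function.update_self]
    · rw [Function.update_of_ne he]; exact hUV e he
  have hW' : Function.update U b' (W b') = W := by
    funext e
    by_cases he : e = b'
    · subst he; rw [Function.update_self]
    · rw [Function.update_of_ne he]; exact hUW e he
  have hZ' : Function.update V b' (W b') = Z := by
    funext e
    by_cases he : e = b'
    · subst he; rw [Function.update_self]; exact hWZ e (Ne.symm hbb')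
    · rw [Function.update_of_ne he]; exact hVZ e he
  have e₂ : Φ₂ x₀ = V := by
    show Function.update x₀.1 b (x₀.2 b) = V
    rw [h2b]; exact hV'
  have e₃ : Φ₃ x₀ = W := by
    show Function.update x₀.1 b' (x₀.2 b') = W
    rw [h2b']; exact hW'
  have e₄ : Φ₄ x₀ = Z := by
    show Function.update (Function.update x₀.1 b (x₀.2 b)) b' (x₀.2 b') = Z
    rw [h2b, h2b']
    show Function.update (Function.update U b (V b)) b' (W b') = Z
    rw [hV']; exact hZ'
  have hx₀O : x₀ ∈ O := by
    refine ⟨hU, ?_, ?_, ?_⟩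
    · rw [e₂]; exact hV
    · rw [e₃]; exact hW
    · rw [e₄]; exact hZ
  have key := hall x₀ hx₀O
  rw [e₂, e₃, e₄] at key
  exact key

/-- **One bond (`b = b′`).** The same from an a.e. hypothesis on the fourfold power `dU^{⊗4}` in the parametrisation
`U = x₀, V = x₀[b ↦ x₁ b], W = x₀[b ↦ x₂ b], Z = x₀[b ↦ x₃ b]`. [folklore] -/
theorem square_le_of_ae_eq [DecidableEq (PBond P j)] [(fieldMeasure P j G).IsOpenPosMeasure]
    {S : Set (GaugeField P j G)} (hS : IsOpen S) {g : GaugeField P j G → ℝ} (hg : ContinuousOn g S) (C : ℝ)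
    (b : PBond P j)
    (hae : ∀ᵐ x ∂(Measure.pi fun _ : Fin 4 => fieldMeasure P j G), x 0 ∈ S → Function.update (x 0) b (x 1 b) ∈ S →
      Function.update (x 0) b (x 2 b) ∈ S → Function.update (x 0) b (x 3 b) ∈ S →
      |g (x 0) - g (Function.update (x 0) b (x 1 b)) - (g (Function.update (x 0) b (x 2 b)) -
        g (Function.update (x 0) b (x 3 b)))| ≤ C) :
    ∀ U V W Z : GaugeField P j G, U ∈ S → V ∈ S → W ∈ S → Z ∈ S → (∀ e, e ≠ b → U e = V e) → (∀ e, e ≠ b → U e = W e) →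
      (∀ e, e ≠ b → V e = Z e) → (∀ e, e ≠ b → W e = Z e) → |g U - g V - (g W - g Z)| ≤ C := by
  intro U V W Z hU hV hW hZ hUV hUW hVZ _hWZ
  set Ψ : Fin 4 → (Fin 4 → GaugeField P j G) → GaugeField P j G := fun i x => Function.update (x 0) b (x i b) with hΨ
  have hc0 : Continuous fun x : Fin 4 → GaugeField P j G => x 0 := continuous_apply 0
  have hcΨ : ∀ i, Continuous (Ψ i) := fun i =>
    hc0.update b ((continuous_apply b).comp (continuous_apply i))
  set O : Set (Fin 4 → GaugeField P j G) := {x | x 0 ∈ S ∧ Ψ 1 x ∈ S ∧ Ψ 2 x ∈ S ∧ Ψ 3 x ∈ S} with hO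
  have hOo : IsOpen O :=
    (hS.preimage hc0).inter ((hS.preimage (hcΨ 1)).inter ((hS.preimage (hcΨ 2)).inter (hS.preimage (hcΨ 3))))
  have hfc : ContinuousOn (fun x => |g (x 0) - g (Ψ 1 x) - (g (Ψ 2 x) - g (Ψ 3 x))|) O :=
    (((hg.comp hc0.continuousOn fun x hx => hx.1).sub (hg.comp (hcΨ 1).continuousOn fun x hx => hx.2.1)).sub
      ((hg.comp (hcΨ 2).continuousOn fun x hx => hx.2.2.1).sub (hg.comp (hcΨ 3).continuousOn fun x hx => hx.2.2.2))).abs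
  have hall := le_on_open_of_ae hOo hfc (C := C) (by
    filter_upwards [hae] with x hx hxO
    exact hx hxO.1 hxO.2.1 hxO.2.2.1 hxO.2.2.2)
  -- the square is `Ψ(x₀)` for `x₀ = (U, V, W, Z)`
  set x₀ : Fin 4 → GaugeField P j G := ![U, V, W, Z] with hx₀
  have hupd : ∀ Y : GaugeField P j G, (∀ e, e ≠ b → U e = Y e) → Function.update U b (Y b) = Y := by
    intro Y hY
    funext e
    by_cases he : e = b
    · subst he; rw [Function.update_self]
    · rw [Function.update_of_ne he]; exact hY e he
  have hUZ : ∀ e, e ≠ b → U e = Z e := fun e he => (hUV e he).trans (hVZ e he)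
  have hx0 : x₀ 0 = U := rfl
  have hx1 : x₀ 1 = V := rfl
  have hx2 : x₀ 2 = W := rfl
  have hx3 : x₀ 3 = Z := rfl
  have e₁ : Ψ 1 x₀ = V := by
    show Function.update (x₀ 0) b (x₀ 1 b) = V
    rw [hx0, hx1]; exact hupd V hUV
  have e₂ : Ψ 2 x₀ = W := by
    show Function.update (x₀ 0) b (x₀ 2 b) = W
    rw [hx0, hx2]; exact hupd W hUW
  have e₃ : Ψ 3 x₀ = Z := by
    show Function.update (x₀ 0) b (x₀ 3 b) = Z
    rw [hx0, hx3]; exact hupd Z hUZ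
  have hx₀O : x₀ ∈ O := by
    refine ⟨?_, ?_, ?_, ?_⟩
    · show x₀ 0 ∈ S
      rw [hx0]; exact hU
    · rw [e₁]; exact hV
    · rw [e₂]; exact hW
    · rw [e₃]; exact hZ
  have key := hall x₀ hx₀O
  rw [hx0, e₁, e₂, e₃] at key
  exact key

end Square

/-! ## §5 The window `{PlaqSmall θ}` is open; the Wilson term is continuous (`G = SU(2)`) -/

section Window

variable {P : Params} {j : ℕ}

/-- **The small-field window `{U : |U(∂p) − 1| < θ ∀ p}` is OPEN** (finitely many strict inequalities between continuous functions).
[cite: Balaban1987RG1, (0.18) p.255] -/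
theorem isOpen_setOf_plaqSmall (θ : ℝ) : IsOpen {U : GaugeField P j (Matrix.specialUnitaryGroup (Fin 2) ℂ) | PlaqSmall θ U} := by
  have h : {U : GaugeField P j (Matrix.specialUnitaryGroup (Fin 2) ℂ) | PlaqSmall θ U} = ⋂ p : Plaq P j, {V | dist1 (GaugeField.plaqHol V p) < θ} := by
    ext V; simp only [PlaqSmall, Set.mem_iInter, Set.mem_setOf_eq]
  rw [h]
  exact isOpen_iInter_of_finite fun p =>
    isOpen_lt ((continuous_dist1_SU (N := 2)).comp (continuous_plaqHol_SU p)) continuous_const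

/-- The Wilson term `a · Σ_p c_p (1 − Re tr U(∂p))` is continuous in the configuration (`Re tr` continuous on `SU(2)`:
`AlphaInputsT3AC.continuous_reTr_su2`). [folklore] -/
theorem continuous_wilsonTerm (a : ℝ) (c : Plaq P j → ℝ) :
    Continuous fun U : GaugeField P j (Matrix.specialUnitaryGroup (Fin 2) ℂ) => a * ∑ p, c p * (1 - reTr (GaugeField.plaqHol U p)) :=
  continuous_const.mul (continuous_finsetSum _ fun p _ =>
    continuous_const.mul (continuous_const.sub
      (Summit.QuantumFields.YangMills.Theorems.AlphaInputsT3AC.continuous_reTr_su2.comp (continuous_plaqHol_SU p))))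

/-- `log r − log r′ − (Wilson term)` is continuous on the window when `r, r′` are continuous and positive there. [folklore] -/
theorem continuousOn_logRatio_sub {S : Set (GaugeField P j (Matrix.specialUnitaryGroup (Fin 2) ℂ))} {r r' : GaugeField P j (Matrix.specialUnitaryGroup (Fin 2) ℂ) → ℝ}
    (hpos : ∀ U, U ∈ S → 0 < r U ∧ 0 < r' U) (hr : ContinuousOn r S) (hr' : ContinuousOn r' S) (a : ℝ) (c : Plaq P j → ℝ) :
    ContinuousOn (fun U => Real.log (r U) - Real.log (r' U) - a * ∑ p, c p * (1 - reTr (GaugeField.plaqHol U p))) S :=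
  ((hr.log fun U hU => (hpos U hU).1.ne').sub (hr'.log fun U hU => (hpos U hU).2.ne')).sub
    (continuous_wilsonTerm a c).continuousOn

end Window

end AeUpgrade

open AeUpgrade

/-! ## §6 Stub U, registered signature verbatim -/

/-- **Stub U of «organ-fibre-laplace» (crux stmt-QuantumFields-23156) — A.E. ⇒ EVERYWHERE on the small-field window**: the a.e. clustered
second-difference clauses for `Λ` (two regimes `b ≠ b′` on `dU ⊗ dU′`, `b = b′` on `dU^{⊗4}`), the a.e. identity `Λ = log r − log r′` on the window and
continuity + positivity of `r, r′` there give the organ's everywhere clause for `log r − log r′ − (L^j/γ)Σ_p c′_p(1 − Re tr U(∂p))`.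
(Registered signature verbatim; proof = §2 transports + §4 square lemmas at `S = {PlaqSmall θ_j}`, `G = SU(2)`.) [folklore] -/
theorem stub_aeUpgrade :
    open scoped Classical in open MeasureTheory ProbabilityTheory Filter Topology Literature.MathematicalPhysics.QuantumFieldTheory.Balaban1983to89 T3ContinuumYM3Torus T3NestedUnitLaws T3UnitLawDensityEML BalabanUVClass T3UnitScaleTilt in ∀ (F : T3Family) (γ b₀ p₀ κ : ℝ) (j : ℕ) (r r' Λ : GaugeField (F.P j) 0 ↥(Matrix.specialUnitaryGroup (Fin 2) ℂ) → ℝ) (c' : Plaq (F.P j) 0 → ℝ) (w' : ℝ), (∀ U, PlaqSmall (θBal F.L γ b₀ p₀ j) U → 0 < r U ∧ 0 < r' U) → ContinuousOn r {U | PlaqSmall (θBal F.L γ b₀ p₀ j) U} → ContinuousOn r' {U | PlaqSmall (θBal F.L γ b₀ p₀ j) U} → (∀ᵐ V ∂(fieldMeasure (F.P j) 0 ↥(Matrix.specialUnitaryGroup (Fin 2) ℂ)), PlaqSmall (θBal F.L γ b₀ p₀ j) V → Λ V = Real.log (r V) - Real.log (r' V)) → (∀ (b b' : PBond (F.P j)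 0), b ≠ b' → ∀ᵐ x ∂((fieldMeasure (F.P j) 0 ↥(Matrix.specialUnitaryGroup (Fin 2) ℂ)).prod (fieldMeasure (F.P j) 0 ↥(Matrix.specialUnitaryGroup (Fin 2) ℂ))), PlaqSmall (θBal F.L γ b₀ p₀ j) x.1 → PlaqSmall (θBal F.L γ b₀ p₀ j) (Function.update x.1 b (x.2 b)) → PlaqSmall (θBal F.L γ b₀ p₀ j) (Function.update x.1 b' (x.2 b')) → PlaqSmall (θBal F.L γ b₀ p₀ j) (Function.update (Function.update x.1 b (x.2 b)) b' (x.2 b')) → |(Λ x.1 - ((F.L : ℝ) ^ j / γ) * ∑ p, c' p * (1 - reTr (GaugeField.plaqHol x.1 p))) - (Λ (Function.update x.1 b (x.2 b)) - ((F.L : ℝ) ^ j / γ) * ∑ p, c' p * (1 - reTr (GaugeField.plaqHol (Function.update x.1 b (x.2 b)) p))) - ((Λ (Function.update x.1 b' (x.2 b')) - ((F.L : ℝ) ^ j / γ) * ∑ p, c' p * (1 - reTr (GaugeField.plaqHol (Function.update x.1 b' (x.2 b')) p))) - (Λ (Function.update (Function.update x.1 b (x.2 b)) b' (x.2 b'))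 - ((F.L : ℝ) ^ j / γ) * ∑ p, c' p * (1 - reTr (GaugeField.plaqHol (Function.update (Function.update x.1 b (x.2 b)) b' (x.2 b')) p))))| ≤ w' * Real.exp (-(κ * (b.src.tdist b'.src : ℝ)))) → (∀ (b : PBond (F.P j) 0), ∀ᵐ x ∂(Measure.pi fun _ : Fin 4 => fieldMeasure (F.P j) 0 ↥(Matrix.specialUnitaryGroup (Fin 2) ℂ)), PlaqSmall (θBal F.L γ b₀ p₀ j) (x 0) → PlaqSmall (θBal F.L γ b₀ p₀ j) (Function.update (x 0) b (x 1 b)) → PlaqSmall (θBal F.L γ b₀ p₀ j) (Function.update (x 0) b (x 2 b)) → PlaqSmall (θBal F.L γ b₀ p₀ j) (Function.update (x 0) b (x 3 b)) → |(Λ (x 0) - ((F.L : ℝ) ^ j / γ) * ∑ p, c' p * (1 - reTr (GaugeField.plaqHol (x 0) p))) - (Λ (Function.update (x 0) b (x 1 b)) - ((F.L : ℝ) ^ j / γ) * ∑ p, c' p * (1 - reTr (GaugeField.plaqHol (Function.update (x 0) b (x 1 b)) p))) - ((Λ (Function.update (x 0) b (x 2 b)) - ((F.L : ℝ) ^ j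 / γ) * ∑ p, c' p * (1 - reTr (GaugeField.plaqHol (Function.update (x 0) b (x 2 b)) p))) - (Λ (Function.update (x 0) b (x 3 b)) - ((F.L : ℝ) ^ j / γ) * ∑ p, c' p * (1 - reTr (GaugeField.plaqHol (Function.update (x 0) b (x 3 b)) p))))| ≤ w' * Real.exp (-(κ * (b.src.tdist b.src : ℝ)))) → (∀ (b b' : PBond (F.P j) 0) U V W Z, PlaqSmall (θBal F.L γ b₀ p₀ j) U → PlaqSmall (θBal F.L γ b₀ p₀ j) V → PlaqSmall (θBal F.L γ b₀ p₀ j) W → PlaqSmall (θBal F.L γ b₀ p₀ j) Z → (∀ e, e ≠ b → U e = V e) → (∀ e, e ≠ b' → U e = W e) → (∀ e, e ≠ b' → V e = Z e) → (∀ e, e ≠ b → W e = Z e) → |(Real.log (r U) - Real.log (r' U) - ((F.L : ℝ) ^ j / γ) * ∑ p, c' p * (1 - reTr (GaugeField.plaqHol U p))) - (Real.log (r V) - Real.log (r' V) - ((F.L : ℝ) ^ j / γ) * ∑ p, c' p * (1 - reTr (GaugeField.plaqHol V p))) - ((Real.log (r W) - Real.log (r' W) - ((F.L : ℝ) ^ j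 / γ) * ∑ p, c' p * (1 - reTr (GaugeField.plaqHol W p))) - (Real.log (r Z) - Real.log (r' Z) - ((F.L : ℝ) ^ j / γ) * ∑ p, c' p * (1 - reTr (GaugeField.plaqHol Z p))))| ≤ w' * Real.exp (-(κ * (b.src.tdist b'.src : ℝ)))) := by
  intro F γ b₀ p₀ κ j r r' Λ c' w' hpos hr hr' hΛ h5 h6 b b'
  classical
  haveI : (fieldMeasure (F.P j) 0 (Matrix.specialUnitaryGroup (Fin 2) ℂ)).IsOpenPosMeasure := isOpenPosMeasure_fieldMeasure_SU 2 (F.P j) 0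
  have hS : IsOpen {U : GaugeField (F.P j) 0 (Matrix.specialUnitaryGroup (Fin 2) ℂ) | PlaqSmall (θBal F.L γ b₀ p₀ j) U} := isOpen_setOf_plaqSmall _
  have hg := continuousOn_logRatio_sub (S := {U : GaugeField (F.P j) 0 (Matrix.specialUnitaryGroup (Fin 2) ℂ) | PlaqSmall (θBal F.L γ b₀ p₀ j) U})
    (fun U hU => hpos U hU) hr hr' ((F.L : ℝ) ^ j / γ) c'
  by_cases hbb' : b = b'
  · subst hbb'
    refine square_le_of_ae_eq hS hg _ b ?_
    have a0 : ∀ᵐ x ∂(Measure.pi fun _ : Fin 4 => fieldMeasure (F.P j) 0 (Matrix.specialUnitaryGroup (Fin 2) ℂ)),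
        PlaqSmall (θBal F.L γ b₀ p₀ j) (x 0) → Λ (x 0) = Real.log (r (x 0)) - Real.log (r' (x 0)) :=
      (MeasureTheory.measurePreserving_eval (fun _ : Fin 4 => fieldMeasure (F.P j) 0 (Matrix.specialUnitaryGroup (Fin 2) ℂ)) 0).quasiMeasurePreserving.ae hΛ
    have a1 := (measurePreserving_update_pi4 (G := Matrix.specialUnitaryGroup (Fin 2) ℂ) b (i := 1) (by decide)).quasiMeasurePreserving.ae hΛ
    have a2 := (measurePreserving_update_pi4 (G := Matrix.specialUnitaryGroup (Fin 2) ℂ) b (i := 2) (by decide)).quasiMeasurePreserving.ae hΛ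
    have a3 := (measurePreserving_update_pi4 (G := Matrix.specialUnitaryGroup (Fin 2) ℂ) b (i := 3) (by decide)).quasiMeasurePreserving.ae hΛ
    filter_upwards [h6 b, a0, a1, a2, a3] with x H k0 k1 k2 k3
    intro s0 s1 s2 s3
    have key := H s0 s1 s2 s3
    rw [k0 s0, k1 s1, k2 s2, k3 s3] at key
    exact key
  · refine square_le_of_ae_ne hS hg _ hbb' ?_
    have a1 := (MeasureTheory.measurePreserving_fst (μ := fieldMeasure (F.P j) 0 (Matrix.specialUnitaryGroup (Fin 2) ℂ))
      (ν := fieldMeasure (F.P j) 0 (Matrix.specialUnitaryGroup (Fin 2) ℂ))).quasiMeasurePreserving.ae hΛ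
    have a2 := (measurePreserving_update_eval (G := Matrix.specialUnitaryGroup (Fin 2) ℂ) b).quasiMeasurePreserving.ae hΛ
    have a3 := (measurePreserving_update_eval (G := Matrix.specialUnitaryGroup (Fin 2) ℂ) b').quasiMeasurePreserving.ae hΛ
    have a4 := (measurePreserving_update_update_eval (G := Matrix.specialUnitaryGroup (Fin 2) ℂ) hbb').quasiMeasurePreserving.ae hΛ
    filter_upwards [h5 b b' hbb', a1, a2, a3, a4] with x H k1 k2 k3 k4
    intro s1 s2 s3 s4
    have key := H s1 s2 s3 s4
    rw [k1 s1, k2 s2, k3 s3, k4 s4] at key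
    exact key

end Summit.QuantumFields.YangMills.Theorems.BackwardLiouvilleRigidity.FibreLaplace
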